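/- Copyright: the b2b-balaban cell (near-miss cell 7), T⁴-continuum fan-out, lineage t4-ne7b-p1 (node U5c COUNT
member).  Released under the licence of the surrounding project. -/
import Summits.QuantumFields.BalabanUV.T4Continuum.Support.HistoryGenealogyInstantiate

/-!
# INSTANTIATION FROM THE LEVEL SETS, part 2 (M3b-2 brick 3b): `WF` of the extracted component bookkeeping
(owner module of row NE7b, lineage `t4-ne7b-p1` gen 40, ruling R-OWNER-40-4; sibling of `HistoryGenealogyInstantiate` —
PRE-POSITIONING ONLY)

Summits-side support leaf of the T⁴-continuum cell (rung (B)+1 on a FINITE torus only; NOT infinite volume, NOT the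
mass gap, NOT the Clay statement; NOT a proof of the spine estimate NE7b, which is the cell's OWN estimate, NOT PRINTED
and NOT PROVED).  [folklore] finite combinatorics over part 1 (`RunInput.hist`, `St_nonempty_disjoint`,
`constit_lab_newLine`, `enumB_spec`, `mem_comp_iff`), brick 2 (`disjoint_of_ne`, `subset_of_mem_tcomps`,
`nonempty_of_mem_tcomps`) and row S13 (`WF`, `lefts`, `rights`); nothing printed is asserted, zero `sorry`.

WHAT IS PROVED.  List lemmas `lefts_map_sumMap`, `rights_map_sumMap`, `nodup_lefts`, `nodup_rights`; `mem_parts_iff`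
(the old parts of a component = the labels of the old vertices of its block), `mem_news_iff`, `not_inl_mem_vert_zero`;
**`wf_hist : (I.hist).WF`** — row S13's printed side conditions HOLD for the bookkeeping extracted from print's
construction: nothing continued into level `0`; duplicate-free lists (the enumeration is duplicate-free and labels are
injective on live lines); parts are previous components, news are the step's new regions; every component has a
constituent (blocks are nonempty); distinct components continue disjoint sets of old components and contain disjoint
sets of new regions (distinct blocks are disjoint).

HONEST.  Proves nothing of Bałaban's; NE7b NOT proved; spine 0∕9.  HONEST DEPENDENCY (cell): continuum YM on T⁴ ⇐
BetaPertH ∧ nine spine estimates (0/9 proved); BetaPertH ⇐ (D1) ∧ (D4) ∧ CAP+tail; G-an2-4 gates asym, D1 and NE2/3/4.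
This file changes none of it. -/

open Finset
open Literature.MathematicalPhysics.QuantumFieldTheory.Balaban1983to89
open Literature.MathematicalPhysics.QuantumFieldTheory.Balaban1983to89.B13ScaleTransfer
open Literature.MathematicalPhysics.QuantumFieldTheory.Balaban1983to89.B16MergeGeometry
open Summit.QuantumFields.BalabanUV.T4Continuum.HistoryGenealogyExtraction
open Summit.QuantumFields.BalabanUV.T4Continuum.HistoryGenealogyRealise
open Summit.QuantumFields.BalabanUV.T4Continuum.HistoryTouchComponents

namespace Summit.QuantumFields.BalabanUV.T4Continuum.HistoryGenealogyInstantiate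

noncomputable section

open Classical

variable {d : ℕ}

namespace RunInput

variable (I : RunInput d)

/-! ## §4 List lemmas: projections of a duplicate-free labelled enumeration -/

/-- `lefts` of a mapped list through `Sum.map` [folklore] -/
theorem lefts_map_sumMap {α α' β β' : Type*} (f : α → α') (g : β → β') :
    ∀ l : List (α ⊕ β), lefts (l.map (Sum.map f g)) = (lefts l).map f
  | [] => rfl
  | Sum.inl a :: l => by simp [lefts_map_sumMap f g l]
  | Sum.inr b :: l => by simp [lefts_map_sumMap f g l]

/-- `rights` of a mapped list through `Sum.map` [folklore] -/
theorem rights_map_sumMap {α α' β β' : Type*} (f : α → α') (g : β → β') :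
    ∀ l : List (α ⊕ β), rights (l.map (Sum.map f g)) = (rights l).map g
  | [] => rfl
  | Sum.inl a :: l => by simp [rights_map_sumMap f g l]
  | Sum.inr b :: l => by simp [rights_map_sumMap f g l]

/-- `lefts` of a duplicate-free list is duplicate-free [folklore] -/
theorem nodup_lefts {α β : Type*} : ∀ {l : List (α ⊕ β)}, l.Nodup → (lefts l).Nodup
  | [], _ => List.nodup_nil
  | Sum.inl a :: l, h => by
      rw [List.nodup_cons] at h
      rw [lefts_cons_inl, List.nodup_cons, mem_lefts_iff]
      exact ⟨h.1, nodup_lefts h.2⟩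
  | Sum.inr b :: l, h => by
      rw [List.nodup_cons] at h
      rw [lefts_cons_inr]
      exact nodup_lefts h.2

/-- `rights` of a duplicate-free list is duplicate-free [folklore] -/
theorem nodup_rights {α β : Type*} : ∀ {l : List (α ⊕ β)}, l.Nodup → (rights l).Nodup
  | [], _ => List.nodup_nil
  | Sum.inl a :: l, h => by
      rw [List.nodup_cons] at h
      rw [rights_cons_inl]
      exact nodup_rights h.2
  | Sum.inr b :: l, h => by
      rw [List.nodup_cons] at h
      rw [rights_cons_inr, List.nodup_cons, mem_rights_iff]
      exact ⟨h.1, nodup_rights h.2⟩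

/-- the old parts of the component of a block: the labels of the old vertices of the block [folklore] -/
theorem mem_parts_iff (hN : I.NewOK) {ℓ : ℕ} {T : Finset (Line d ⊕ Lab d)} (hT : T ∈ I.blocks ℓ (I.Prev ℓ)) {p : Lab d} :
    p ∈ I.hist.parts ℓ (lab (I.newLine ℓ T)) ↔ ∃ τ, Sum.inl τ ∈ T ∧ lab τ = p := by
  rw [ComponentHistory.parts, I.constit_lab_newLine hN hT, toLab, lefts_map_sumMap, List.mem_map]
  simp only [mem_lefts_iff, (I.enumB_spec hT).2.1]

/-- the new regions of the component of a block: the new vertices of the block [folklore] -/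
theorem mem_news_iff (hN : I.NewOK) {ℓ : ℕ} {T : Finset (Line d ⊕ Lab d)} (hT : T ∈ I.blocks ℓ (I.Prev ℓ)) {n : Lab d} :
    n ∈ I.hist.news ℓ (lab (I.newLine ℓ T)) ↔ Sum.inr n ∈ T := by
  rw [ComponentHistory.news, I.constit_lab_newLine hN hT, toLab, rights_map_sumMap, List.map_id, mem_rights_iff]
  exact (I.enumB_spec hT).2.1 _

/-! ## §5 Well-formedness of the extracted bookkeeping -/

/-- at level `0` there are no old vertices [folklore] -/
theorem not_inl_mem_vert_zero (τ : Line d) : Sum.inl τ ∉ I.vert 0 (I.Prev 0) := by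
  simp [vert, Prev]

/-- **`WF` OF THE EXTRACTED BOOKKEEPING** (under `NewOK`). [folklore] -/
theorem wf_hist (hN : I.NewOK) : I.hist.WF where
  parts_zero c := by
    by_cases h : ∃ T ∈ I.blocks 0 (I.Prev 0), lab (I.newLine 0 T) = c
    · obtain ⟨T, hT, rfl⟩ := h
      rw [List.eq_nil_iff_forall_not_mem]
      intro p hp
      obtain ⟨τ, hτT, -⟩ := (I.mem_parts_iff hN hT).1 hp
      exact I.not_inl_mem_vert_zero τ (subset_of_mem_tcomps hT hτT)
    · simp [ComponentHistory.parts, I.constit_eq_nil h]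
  parts_nodup ℓ c := by
    by_cases h : ∃ T ∈ I.blocks ℓ (I.Prev ℓ), lab (I.newLine ℓ T) = c
    · obtain ⟨T, hT, rfl⟩ := h
      rw [ComponentHistory.parts, I.constit_lab_newLine hN hT, toLab, lefts_map_sumMap]
      refine (nodup_lefts (I.enumB_spec hT).1).map_on fun τ hτ τ' hτ' hl => ?_
      have hτv := subset_of_mem_tcomps hT (((I.enumB_spec hT).2.1 _).1 ((mem_lefts_iff τ _).1 hτ))
      have hτv' := subset_of_mem_tcomps hT (((I.enumB_spec hT).2.1 _).1 ((mem_lefts_iff τ' _).1 hτ'))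
      cases ℓ with
      | zero => exact absurd hτv (I.not_inl_mem_vert_zero τ)
      | succ ℓ => exact I.lab_injOn_St hN ℓ ((I.inl_mem_vert).1 hτv).1 ((I.inl_mem_vert).1 hτv').1 hl
    · simp [ComponentHistory.parts, I.constit_eq_nil h]
  news_nodup ℓ c := by
    by_cases h : ∃ T ∈ I.blocks ℓ (I.Prev ℓ), lab (I.newLine ℓ T) = c
    · obtain ⟨T, hT, rfl⟩ := h
      rw [ComponentHistory.news, I.constit_lab_newLine hN hT, toLab, rights_map_sumMap, List.map_id]
      exact nodup_rights (I.enumB_spec hT).1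
    · simp [ComponentHistory.news, I.constit_eq_nil h]
  parts_sub ℓ c hc p hp := by
    obtain ⟨T, hT, rfl⟩ := I.mem_comp_iff.1 hc
    obtain ⟨τ, hτT, rfl⟩ := (I.mem_parts_iff hN hT).1 hp
    have hτ := ((I.inl_mem_vert).1 (subset_of_mem_tcomps hT hτT)).1
    exact Finset.mem_image.2 ⟨τ, hτ, rfl⟩
  news_sub ℓ c hc n hn := by
    obtain ⟨T, hT, rfl⟩ := I.mem_comp_iff.1 hc
    exact (I.inr_mem_vert).1 (subset_of_mem_tcomps hT ((I.mem_news_iff hN hT).1 hn))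
  nonempty ℓ c hc := by
    obtain ⟨T, hT, rfl⟩ := I.mem_comp_iff.1 hc
    rw [I.constit_lab_newLine hN hT]
    obtain ⟨v, hv⟩ := nonempty_of_mem_tcomps hT
    have hv' := ((I.enumB_spec hT).2.1 v).2 hv
    intro h
    rw [List.map_eq_nil_iff] at h
    rw [h] at hv'
    simp at hv'
  parts_disj ℓ c c' hc hc' hne := by
    obtain ⟨T, hT, rfl⟩ := I.mem_comp_iff.1 hc
    obtain ⟨T', hT', rfl⟩ := I.mem_comp_iff.1 hc'
    have hTT : T ≠ T' := fun h => hne (by rw [h])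
    rw [Finset.disjoint_left]
    intro p hp hp'
    rw [List.mem_toFinset] at hp hp'
    obtain ⟨τ, hτT, rfl⟩ := (I.mem_parts_iff hN hT).1 hp
    obtain ⟨τ', hτ'T, hl⟩ := (I.mem_parts_iff hN hT').1 hp'
    have hτv := (I.inl_mem_vert).1 (subset_of_mem_tcomps hT hτT)
    have hτv' := (I.inl_mem_vert).1 (subset_of_mem_tcomps hT' hτ'T)
    have heq : τ' = τ := I.lab_injOn_St hN ℓ hτv'.1 hτv.1 hl
    subst heq
    exact Finset.disjoint_left.1 (disjoint_of_ne hT hT' hTT) hτT hτ'T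
  news_disj ℓ c c' hc hc' hne := by
    obtain ⟨T, hT, rfl⟩ := I.mem_comp_iff.1 hc
    obtain ⟨T', hT', rfl⟩ := I.mem_comp_iff.1 hc'
    have hTT : T ≠ T' := fun h => hne (by rw [h])
    rw [Finset.disjoint_left]
    intro n hn hn'
    rw [List.mem_toFinset] at hn hn'
    exact Finset.disjoint_left.1 (disjoint_of_ne hT hT' hTT) ((I.mem_news_iff hN hT).1 hn) ((I.mem_news_iff hN hT').1 hn')

end RunInput

end

end Summit.QuantumFields.BalabanUV.T4Continuum.HistoryGenealogyInstantiate
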